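import Summits.ResolutionOfSingularities.ResolutionOfSingularities.Theorems.FrobeniusClosingSteerCriticalSurface
import Mathlib.RingTheory.Derivation.Basic
import HarnessLib

/-!
# Crux `Steer` (stmt-ResolutionOfSingularities-16345), chain W4.1, p = 2 σ-residual, LOW half: the LOW-SHAPE-WITH-DUALS normalisation
# (A1′) — from a polar-rank-2 presentation `f − g² − z·w ∈ 𝔪³` at a NON-high stage and ANY dual coordinate system, extend `(z, w)` to
# generators `(z, w, l₃, l₄)` of `𝔪` with derivations `D₁, D₂` DUAL to `(z, w)` (Theses-free, def-free)

OURS (campaign `res-hironaka`, rung L ★L-G4, slot W4.1; res-L0-w41-plan-1 RULINGS 39b / 41′ / 42 «(A1′) LOW-shape-with-duals := res-type-072»;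
the bridge between res-L0-w41-strat-2's §σ2.23 PART A words (`HasDualDerivations`, `f − g² − z·w ∈ 𝔪³`, `¬ IsHighOrderAt`) and the
«low shape with dual derivations» binders of the tree's C1/C2/C3 (p511593), C5 (p514735), C7 (p513150), C8 (p517667), (Σ↑) (p518735).
Replaces the role of no printed item; NOT a statement of the manuscript under review [claim: Hironaka2017, status: under-review]; AI review is
weaker than expert review.)

## Statement (`CriticalSurface.exists_lowShape_duals`)

`(R, 𝔪)` a Noetherian local ring of characteristic `2` whose residues are squares (`∀ a, ∃ b, a − b² ∈ 𝔪`), `y : Fin 4 → R` generating `𝔪`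
with derivations `D a` DUAL to `y` (`D a (y b) = δ_{ab}` — strat-2's `HasDualDerivations` UNFOLDED), `z, w ∈ 𝔪` with `f − g² − z·w ∈ 𝔪³`
and `f` NOT high (`f − g'² ∉ 𝔪³` for every `g'`). Then there are `l₃, l₄, c ∈ R` and derivations `D₁, D₂` with
`f − g² = z·w + c`, `c ∈ 𝔪³`, `(z, w, l₃, l₄) = 𝔪`, `D₁ z = 1, D₁ w = 0, D₂ z = 0, D₂ w = 1`.

## Proof

(N0) COORDINATES: `m − Σ_a (D a m)·y a ∈ 𝔪²` for `m ∈ 𝔪`. (N1) NOT HIGH ⇒ `z ∉ 𝔪²` and `w ∉ R·z + 𝔪²`: otherwise, writing the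
coefficient `λ = μ² + ν` (`ν ∈ 𝔪`, residues are squares), `f − (g + μ z)² = (f − g² − z w) + z (w − λ z) + ν z² ∈ 𝔪³` in characteristic `2`.
(N2) Hence some `2 × 2` minor `Δ = D a₁ z · D a₂ w − D a₂ z · D a₁ w` of the `2 × 4` matrix `(D a z, D a w)` is a UNIT (if all minors lie in
`𝔪`, pick `a₀` with `D a₀ z` a unit, then `w − λ z ∈ 𝔪²` with `λ = D a₀ w / D a₀ z`). (N3) CRAMER: `D₁ := Δ⁻¹ (D a₂ w · D a₁ − D a₁ w · D a₂)`,
`D₂ := Δ⁻¹ (D a₁ z · D a₂ − D a₂ z · D a₁)` are dual to `(z, w)`. (N4) COMPLETION: with `{a₃, a₄}` the other two indices and `l₃ := y a₃`,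
`l₄ := y a₄`, Cramer on (N0) puts `y a₁, y a₂` in `(z, w, l₃, l₄) + 𝔪²`, so `𝔪 ⊆ (z, w, l₃, l₄) + 𝔪²` and Nakayama concludes.

Consumers: the leaf `lowSurfaceStepExitsTwo_holds` for strat-2's PART A C8 Prop (words of record, RULING 39b) over this file + p517667;
res-D-pv-012's D3a (A1′) at every LOW stage. [cite: Matsumura1987, Thm. 14.2] [cite: AtiyahMacdonald1969, Prop. 2.6] [folklore]
-/

noncomputable section

-- `Summit.<S>.<S>.…` duplicates the summit name by design (single-problem summit).
set_option linter.dupNamespace false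

open IsLocalRing

namespace Summit.ResolutionOfSingularities.ResolutionOfSingularities.Theorems.SwitchingDichotomy.CriticalSurface

universe u

/-! ## Bookkeeping on `Fin 4` -/

/-- Two distinct indices in `Fin 4` have two further indices completing them to all of `Fin 4` (bookkeeping, by `decide`). [folklore] -/
theorem exists_compl_pair_fin_four (a₁ a₂ : Fin 4) (h : a₁ ≠ a₂) :
    ∃ a₃ a₄ : Fin 4, a₁ ≠ a₃ ∧ a₁ ≠ a₄ ∧ a₂ ≠ a₃ ∧ a₂ ≠ a₄ ∧ a₃ ≠ a₄ ∧
      ∀ b : Fin 4, b = a₁ ∨ b = a₂ ∨ b = a₃ ∨ b = a₄ := by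
  revert a₁ a₂
  decide

/-- A sum over `Fin 4` written out along four distinct indices covering `Fin 4` (bookkeeping). [folklore] -/
theorem sum_eq_four {M : Type*} [AddCommMonoid M] (v : Fin 4 → M) {a₁ a₂ a₃ a₄ : Fin 4}
    (h12 : a₁ ≠ a₂) (h13 : a₁ ≠ a₃) (h14 : a₁ ≠ a₄) (h23 : a₂ ≠ a₃) (h24 : a₂ ≠ a₄) (h34 : a₃ ≠ a₄)
    (hcov : ∀ b : Fin 4, b = a₁ ∨ b = a₂ ∨ b = a₃ ∨ b = a₄) :
    ∑ b, v b = v a₁ + v a₂ + v a₃ + v a₄ := by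
  classical
  have huniv : (Finset.univ : Finset (Fin 4)) = {a₁, a₂, a₃, a₄} := by
    ext b
    simp only [Finset.mem_univ, Finset.mem_insert, Finset.mem_singleton, true_iff]
    exact hcov b
  rw [huniv, Finset.sum_insert (by simp [h12, h13, h14]), Finset.sum_insert (by simp [h23, h24]),
    Finset.sum_insert (by simp [h34]), Finset.sum_singleton]
  simp only [add_assoc]

/-! ## (N0) Coordinates modulo `𝔪²` from a dual system -/

section Coordinates

variable {R : Type u} [CommRing R] [IsLocalRing R]

/-- **(N0) Coordinates.** If `y : Fin 4 → R` generates `𝔪` and the derivations `D a` are dual to `y`, then every `m ∈ 𝔪` satisfies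
`m ≡ Σ_a (D a m) · y a (mod 𝔪²)`: writing `m = Σ c_b y_b`, `D a m = c_a + Σ_b (D a c_b) y_b ≡ c_a (mod 𝔪)`. [folklore] -/
theorem sub_sum_derivation_mul_mem_sq (y : Fin 4 → R) (D : Fin 4 → Derivation ℤ R R)
    (hy : Ideal.span (Set.range y) = maximalIdeal R) (hD : ∀ a b, D a (y b) = if a = b then 1 else 0)
    (m : R) (hm : m ∈ maximalIdeal R) : m - ∑ a, D a m * y a ∈ maximalIdeal R ^ 2 := by
  classical
  have hym : ∀ a, y a ∈ maximalIdeal R := fun a => hy ▸ Ideal.subset_span ⟨a, rfl⟩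
  rw [← hy] at hm
  obtain ⟨c, rfl⟩ := (Submodule.mem_span_range_iff_exists_fun R).mp hm
  -- `D a (Σ c_b y_b) = c_a + Σ_b (D a c_b) y_b`
  have hDa : ∀ a, D a (∑ b, c b • y b) - c a ∈ maximalIdeal R := by
    intro a
    have hexp : D a (∑ b, c b • y b) = ∑ b, (D a (c b) * y b + c b * D a (y b)) := by
      rw [map_sum]
      refine Finset.sum_congr rfl fun b _ => ?_
      rw [smul_eq_mul, (D a).leibniz, smul_eq_mul, smul_eq_mul]
      ring
    have hsplit : ∑ b, (D a (c b) * y b + c b * D a (y b)) = ∑ b, D a (c b) * y b + c a := by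
      rw [Finset.sum_add_distrib]
      congr 1
      rw [Finset.sum_eq_single a]
      · rw [hD, if_pos rfl, mul_one]
      · intro b _ hb; rw [hD, if_neg (Ne.symm hb), mul_zero]
      · intro h; exact absurd (Finset.mem_univ a) h
    rw [hexp, hsplit, add_sub_cancel_right]
    exact Ideal.sum_mem _ fun b _ => Ideal.mul_mem_left _ _ (hym b)
  have hrew : ∑ b, c b • y b - ∑ a, D a (∑ b, c b • y b) * y a =
      ∑ a, (c a - D a (∑ b, c b • y b)) * y a := by
    simp only [smul_eq_mul, sub_mul, Finset.sum_sub_distrib]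
  rw [hrew, pow_two]
  refine Ideal.sum_mem _ fun a _ => Ideal.mul_mem_mul ?_ (hym a)
  have := neg_mem (hDa a)
  rwa [neg_sub] at this

end Coordinates

/-! ## (N1)–(N4) The normalisation -/

section Normalisation

variable {R : Type u} [CommRing R] [IsLocalRing R] [CharP R 2]

/-- **(N1) Not high ⇒ `w ∉ R·z + 𝔪²`** (residues squares, characteristic `2`): if `w − λ z ∈ 𝔪²` then, with `λ − μ² ∈ 𝔪`,
`f − (g + μ z)² = (f − g² − z w) + z (w − λ z) + (λ − μ²) z² ∈ 𝔪³`. [folklore] -/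
theorem not_sub_mul_mem_sq_of_not_high (hperf : ∀ a : R, ∃ b : R, a - b ^ 2 ∈ maximalIdeal R)
    (f g z w : R) (hz : z ∈ maximalIdeal R) (hf : f - g ^ 2 - z * w ∈ maximalIdeal R ^ 3)
    (hlow : ∀ g' : R, f - g' ^ 2 ∉ maximalIdeal R ^ 3) (lam : R) : w - lam * z ∉ maximalIdeal R ^ 2 := by
  intro hmem
  obtain ⟨μ, hμ⟩ := hperf lam
  have h2 : (2 : R) = 0 := by
    have := CharP.cast_eq_zero R 2
    simpa using this
  apply hlow (g + μ * z)
  have e : f - (g + μ * z) ^ 2 = (f - g ^ 2 - z * w) + z * (w - lam * z) + (lam - μ ^ 2) * (z * z) - (g * μ * z) * 2 := by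
    ring
  rw [e, h2, mul_zero, sub_zero]
  refine add_mem (add_mem hf ?_) ?_
  · rw [show (3 : ℕ) = 2 + 1 from rfl, pow_succ']
    exact Ideal.mul_mem_mul hz hmem
  · have e2 : (lam - μ ^ 2) * (z * z) = ((lam - μ ^ 2) * z) * z := by ring
    rw [e2, show (3 : ℕ) = 2 + 1 from rfl, pow_succ]
    exact Ideal.mul_mem_mul (by rw [pow_two]; exact Ideal.mul_mem_mul hμ hz) hz

/-- **(A1′) LOW SHAPE WITH DUALS — the normalisation.** `(R, 𝔪)` Noetherian local of characteristic `2` with square residues, `y` a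
generating system of `𝔪` with dual derivations `D` (strat-2's `HasDualDerivations` UNFOLDED), `z, w ∈ 𝔪`, `f − g² − z·w ∈ 𝔪³`, and `f` not
high. Then `(z, w)` extends to generators `(z, w, l₃, l₄)` of `𝔪` carrying derivations `D₁, D₂` dual to `(z, w)`, and `f − g² = z·w + c` with
`c ∈ 𝔪³` — exactly the «low shape with duals» binders of C1/C2/C3/C5/C7/C8/(Σ↑) with `l₁ := z`, `l₂ := w`. OURS.
[cite: Matsumura1987, Thm. 14.2] [cite: AtiyahMacdonald1969, Prop. 2.6] [folklore] -/
theorem exists_lowShape_duals [IsNoetherianRing R] (hperf : ∀ a : R, ∃ b : R, a - b ^ 2 ∈ maximalIdeal R)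
    (y : Fin 4 → R) (D : Fin 4 → Derivation ℤ R R) (hy : Ideal.span (Set.range y) = maximalIdeal R)
    (hD : ∀ a b, D a (y b) = if a = b then 1 else 0)
    (f g z w : R) (hz : z ∈ maximalIdeal R) (hw : w ∈ maximalIdeal R) (hf : f - g ^ 2 - z * w ∈ maximalIdeal R ^ 3)
    (hlow : ∀ g' : R, f - g' ^ 2 ∉ maximalIdeal R ^ 3) :
    ∃ (l₃ l₄ c : R) (D₁ D₂ : Derivation ℤ R R), f - g ^ 2 = z * w + c ∧ c ∈ maximalIdeal R ^ 3 ∧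
      Ideal.span {z, w, l₃, l₄} = maximalIdeal R ∧ D₁ z = 1 ∧ D₁ w = 0 ∧ D₂ z = 0 ∧ D₂ w = 1 := by
  classical
  have hym : ∀ a, y a ∈ maximalIdeal R := fun a => hy ▸ Ideal.subset_span ⟨a, rfl⟩
  have hcoz := sub_sum_derivation_mul_mem_sq y D hy hD z hz
  have hcow := sub_sum_derivation_mul_mem_sq y D hy hD w hw
  -- (N1a) some `D a z` is a unit
  have hzunit : ∃ a₀, IsUnit (D a₀ z) := by
    by_contra hall
    push Not at hall
    have hsum : ∑ a, D a z * y a ∈ maximalIdeal R ^ 2 := by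
      rw [pow_two]
      exact Ideal.sum_mem _ fun a _ =>
        Ideal.mul_mem_mul ((IsLocalRing.mem_maximalIdeal _).mpr (mem_nonunits_iff.mpr (hall a))) (hym a)
    have hz2 : z ∈ maximalIdeal R ^ 2 := by
      have := add_mem hcoz hsum
      rwa [sub_add_cancel] at this
    apply hlow g
    have e : f - g ^ 2 = (f - g ^ 2 - z * w) + z * w := by ring
    rw [e]
    refine add_mem hf ?_
    rw [show (3 : ℕ) = 2 + 1 from rfl, pow_succ]
    exact Ideal.mul_mem_mul hz2 hw
  -- (N2) some `2 × 2` minor is a unit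
  have hminor : ∃ a₁ a₂, IsUnit (D a₁ z * D a₂ w - D a₂ z * D a₁ w) := by
    by_contra hall
    push Not at hall
    obtain ⟨a₀, hu0⟩ := hzunit
    obtain ⟨v, hv⟩ := hu0.exists_left_inv
    set lam : R := D a₀ w * v with hlam
    have hkey : ∀ b, D b w - lam * D b z ∈ maximalIdeal R := by
      intro b
      have hmin : D a₀ z * D b w - D b z * D a₀ w ∈ maximalIdeal R :=
        (IsLocalRing.mem_maximalIdeal _).mpr (mem_nonunits_iff.mpr (hall a₀ b))
      have e : D a₀ z * (D b w - lam * D b z) = D a₀ z * D b w - D b z * D a₀ w := by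
        rw [hlam]
        linear_combination (-(D a₀ w * D b z)) * hv
      rw [← e] at hmin
      exact (Ideal.unit_mul_mem_iff_mem _ hu0).mp hmin
    apply not_sub_mul_mem_sq_of_not_high hperf f g z w hz hf hlow lam
    -- `w − λ z ≡ Σ_b (D b w − λ D b z) y_b  (mod 𝔪²)`
    have hsum : ∑ b, (D b w - lam * D b z) * y b = ∑ b, D b w * y b - lam * ∑ b, D b z * y b := by
      rw [Finset.mul_sum, ← Finset.sum_sub_distrib]
      exact Finset.sum_congr rfl fun b _ => by ring
    have e : w - lam * z = (w - ∑ b, D b w * y b) - lam * (z - ∑ b, D b z * y b) +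
        ∑ b, (D b w - lam * D b z) * y b := by
      rw [hsum]; ring
    rw [e]
    refine add_mem (sub_mem hcow (Ideal.mul_mem_left _ _ hcoz)) ?_
    rw [pow_two]
    exact Ideal.sum_mem _ fun b _ => Ideal.mul_mem_mul (hkey b) (hym b)
  obtain ⟨a₁, a₂, hΔ⟩ := hminor
  set Δ : R := D a₁ z * D a₂ w - D a₂ z * D a₁ w with hΔdef
  obtain ⟨Δi, hΔi⟩ := hΔ.exists_left_inv
  have hΔi' : Δi * (D a₁ z * D a₂ w - D a₂ z * D a₁ w) = 1 := by rw [← hΔdef]; exact hΔi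
  have h12 : a₁ ≠ a₂ := by
    rintro rfl
    have h0 : Δ = 0 := by simp only [hΔdef, sub_self]
    rw [h0] at hΔ
    exact not_isUnit_zero hΔ
  -- (N3) Cramer: the dual derivations
  let D₁ : Derivation ℤ R R := Δi • (D a₂ w • D a₁ - D a₁ w • D a₂)
  let D₂ : Derivation ℤ R R := Δi • (D a₁ z • D a₂ - D a₂ z • D a₁)
  have hD₁ : ∀ x, D₁ x = Δi * (D a₂ w * D a₁ x - D a₁ w * D a₂ x) := fun x => by
    simp only [D₁, Derivation.smul_apply, Derivation.sub_apply, smul_eq_mul]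
  have hD₂ : ∀ x, D₂ x = Δi * (D a₁ z * D a₂ x - D a₂ z * D a₁ x) := fun x => by
    simp only [D₂, Derivation.smul_apply, Derivation.sub_apply, smul_eq_mul]
  have h11 : D₁ z = 1 := by rw [hD₁]; linear_combination hΔi'
  have h12' : D₁ w = 0 := by rw [hD₁]; ring
  have h21 : D₂ z = 0 := by rw [hD₂]; ring
  have h22 : D₂ w = 1 := by rw [hD₂]; exact hΔi'
  -- (N4) completion: the other two coordinates
  obtain ⟨a₃, a₄, h13, h14, h23, h24, h34, hcov⟩ := exists_compl_pair_fin_four a₁ a₂ h12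
  set N : Ideal R := Ideal.span {z, w, y a₃, y a₄} with hN
  have hzN : z ∈ N := Ideal.subset_span (by simp)
  have hwN : w ∈ N := Ideal.subset_span (by simp)
  have h3N : y a₃ ∈ N := Ideal.subset_span (by simp)
  have h4N : y a₄ ∈ N := Ideal.subset_span (by simp)
  have hNle : N ≤ maximalIdeal R := by
    rw [hN, Ideal.span_le]
    simp only [Set.insert_subset_iff, Set.singleton_subset_iff, SetLike.mem_coe]
    exact ⟨hz, hw, hym a₃, hym a₄⟩
  -- `t_z := z − D a₃ z · y a₃ − D a₄ z · y a₄ ≡ D a₁ z · y a₁ + D a₂ z · y a₂ (mod 𝔪²)`, same for `w`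
  have hsz : ∑ b, D b z * y b = D a₁ z * y a₁ + D a₂ z * y a₂ + D a₃ z * y a₃ + D a₄ z * y a₄ :=
    sum_eq_four (fun b => D b z * y b) h12 h13 h14 h23 h24 h34 hcov
  have hsw : ∑ b, D b w * y b = D a₁ w * y a₁ + D a₂ w * y a₂ + D a₃ w * y a₃ + D a₄ w * y a₄ :=
    sum_eq_four (fun b => D b w * y b) h12 h13 h14 h23 h24 h34 hcov
  set tz : R := z - D a₃ z * y a₃ - D a₄ z * y a₄ with htz
  set tw : R := w - D a₃ w * y a₃ - D a₄ w * y a₄ with htw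
  have htzN : tz ∈ N := sub_mem (sub_mem hzN (Ideal.mul_mem_left _ _ h3N)) (Ideal.mul_mem_left _ _ h4N)
  have htwN : tw ∈ N := sub_mem (sub_mem hwN (Ideal.mul_mem_left _ _ h3N)) (Ideal.mul_mem_left _ _ h4N)
  have htz2 : tz - (D a₁ z * y a₁ + D a₂ z * y a₂) ∈ maximalIdeal R ^ 2 := by
    have e : tz - (D a₁ z * y a₁ + D a₂ z * y a₂) = z - ∑ b, D b z * y b := by rw [hsz, htz]; ring
    rw [e]; exact hcoz
  have htw2 : tw - (D a₁ w * y a₁ + D a₂ w * y a₂) ∈ maximalIdeal R ^ 2 := by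
    have e : tw - (D a₁ w * y a₁ + D a₂ w * y a₂) = w - ∑ b, D b w * y b := by rw [hsw, htw]; ring
    rw [e]; exact hcow
  -- Cramer: `Δ · y a₁`, `Δ · y a₂ ∈ N + 𝔪²`
  have hy1 : y a₁ ∈ N ⊔ maximalIdeal R ^ 2 := by
    have e : y a₁ = Δi * (D a₂ w * tz - D a₂ z * tw) -
        Δi * (D a₂ w * (tz - (D a₁ z * y a₁ + D a₂ z * y a₂)) - D a₂ z * (tw - (D a₁ w * y a₁ + D a₂ w * y a₂))) := by
      linear_combination (-(y a₁)) * hΔi'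
    rw [e]
    exact sub_mem
      (Ideal.mem_sup_left (Ideal.mul_mem_left _ _ (sub_mem (Ideal.mul_mem_left _ _ htzN) (Ideal.mul_mem_left _ _ htwN))))
      (Ideal.mem_sup_right (Ideal.mul_mem_left _ _ (sub_mem (Ideal.mul_mem_left _ _ htz2) (Ideal.mul_mem_left _ _ htw2))))
  have hy2 : y a₂ ∈ N ⊔ maximalIdeal R ^ 2 := by
    have e : y a₂ = Δi * (D a₁ z * tw - D a₁ w * tz) -
        Δi * (D a₁ z * (tw - (D a₁ w * y a₁ + D a₂ w * y a₂)) - D a₁ w * (tz - (D a₁ z * y a₁ + D a₂ z * y a₂))) := by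
      linear_combination (-(y a₂)) * hΔi'
    rw [e]
    exact sub_mem
      (Ideal.mem_sup_left (Ideal.mul_mem_left _ _ (sub_mem (Ideal.mul_mem_left _ _ htwN) (Ideal.mul_mem_left _ _ htzN))))
      (Ideal.mem_sup_right (Ideal.mul_mem_left _ _ (sub_mem (Ideal.mul_mem_left _ _ htw2) (Ideal.mul_mem_left _ _ htz2))))
  -- every `y b` lies in `N + 𝔪²`, hence `𝔪 ≤ N + 𝔪²`, and Nakayama
  have hyall : ∀ b, y b ∈ N ⊔ maximalIdeal R ^ 2 := by
    intro b
    rcases hcov b with rfl | rfl | rfl | rfl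
    · exact hy1
    · exact hy2
    · exact Ideal.mem_sup_left h3N
    · exact Ideal.mem_sup_left h4N
  have hle : maximalIdeal R ≤ N ⊔ maximalIdeal R • maximalIdeal R := by
    rw [Ideal.smul_eq_mul, ← pow_two]
    conv_lhs => rw [← hy]
    rw [Ideal.span_le]
    rintro _ ⟨b, rfl⟩
    exact hyall b
  have hspan : N = maximalIdeal R :=
    le_antisymm hNle (Submodule.le_of_le_smul_of_le_jacobson_bot (IsNoetherian.noetherian _)
      (IsLocalRing.maximalIdeal_le_jacobson ⊥) hle)
  refine ⟨y a₃, y a₄, f - g ^ 2 - z * w, D₁, D₂, by ring, hf, ?_, h11, h12', h21, h22⟩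
  rw [← hN]
  exact hspan

end Normalisation

end Summit.ResolutionOfSingularities.ResolutionOfSingularities.Theorems.SwitchingDichotomy.CriticalSurface

end
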